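import Literature.MathematicalPhysics.QuantumFieldTheory.Balaban1983to89.T4HistoryLipschitzLinearSize

/-!
# NE9PrintedMajorantDecay — the wall (A″) of the NE9-P2 end-to-end theorems RE-TYPED IN PRINT'S OWN CURRENCY: decay of the
box majorant in Bałaban's LINEAR SIZE `d(Z)` of the polymer (the literal TYPE of [II] Lemma 3 (2.38)) instead of decay in the
number of cubes, and the lineage's END `NE9 ∧ FadingMemory` on the torus cube chart with BOTH displayed decays ((L‴) of the
coefficient tables and (A″) of the box majorant) in d-currency (cell `pub-balaban`, T4-DAG §2 node U3 / §6 NE9; lineage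
t4-ne9-p2 = prover P2 «inductive route», generation 19; task F5 of the ROUND-2 skeleton `HOME/t4/skeletons/NE9-t4-ne9-p2.md` §4,
leaf L11)

HONEST FRAMING (T4-DAG PAGE 1).  Rung (B)+1 on a FIXED finite torus — NOT infinite volume, NOT a mass gap, NOT the Clay problem.
NE9 is a cell NEW ESTIMATE, NOT PRINTED, and is NOT discharged here; every analytic input stays a DISPLAYED binder.  [II] =
[Balaban1988RG2Cluster] is quoted for TYPES only (ABSOLUTE RULE): Lemma 3 p. 20 (schematic transcription, flagged)
`|H(Z)| ≤ C₃ε₁ exp(−(1 − 8δ)½Lκd_{k+1}(Z))`, Z ∈ 𝐃_{k+1} — a decay bound in the LINEAR SIZE `d_{k+1}(Z)` of [I] p. 257 for Bałaban's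
ONE table 𝐕_k; its uniformity over the (1.36)-box of tables is the lineage's READING (XREAD (x3) CONFIRMED as a reading,
C-ne5p2g5-1), displayed, asserted nowhere.  `FlowStep.BetaPertH`, (B), (B^μ) do not occur.

WHERE THIS SITS.  The END face `T4HistoryLipschitzLinearSize.torus_ne9_and_fadingMemory_of_linSizeDecay` (v1.0.2 p193088) displays
the wall (A″) as `hdecay₀ : ∫‖pre_ω‖·e^{boxExponent} dμ ≤ ε k·y^{#γ′}` — decay in the NUMBER OF CUBES of the polymer γ′ — while print
states decay in `d_{k+1}`.  On the torus chart the polymers of the step volume `Γ.vol X = connFamilies (torusAdj ν N) (region X)` are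
WALL-CONNECTED cube families ([I] p. 257 «Such a domain is a union of a connected, finite family of cubes»), so the lineage's
corrected lower half of (2.30) (`T4HistoryLipschitzLinearSize.exp_neg_mul_linSize_le`: `e^{−a′·d(Z)} ≤ e^{a′}·(e^{−a′/2^ν})^{#Z}` for
every Z with a skeleton) converts the printed-currency decay `ε′ k·e^{−a′·d(γ′)}` into the END's cube-count currency with
`ε k := ε′ k·e^{a′}`, `y := e^{−a′/2^ν}`.  Nothing else changes.

WHAT IS PROVED (kernel, `[folklore]` bookkeeping; 0 sorry).
§1 `boxMajorantDecay_of_linSizeDecay` — on a torus cube chart, decay of the box majorant in `linSize γ′` at every occurring coupling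
   ⟹ the `hdecay₀` binder of the END with `(ε′ k·e^{a′}, e^{−a′/2^ν})`.
§2 **`torus_ne9_and_fadingMemory_of_printedDecay`** — `torus_ne9_and_fadingMemory_of_linSizeDecay` with `hdecay₀` REPLACED by the
   d-currency decay `hdecayLin` and the two KP scalars re-lettered (`hθ : 2e^{−a′/2^ν}·e^{a₁+d₁}·e^{Dθ} ≤ θ`,
   `hεθ : 2ε′ k e^{a′}·θ·(D+1) ≤ a₁`); conclusion unchanged: `NE9 E W κ (prodModuli ℓ fun _ => μ) ∧ FadingMemory (ℓ/μ) μ (…)`,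
   `μ = ω + 4·lipbar·a₁·τ̄`.  Now BOTH displayed decays of the activity side — (L‴) `hlin` (coefficient tables, (2.18)×(1.36)) and
   (A″) `hdecayLin` (box majorant, (2.38)) — are in Bałaban's d-currency; their class-uniformity remains the reading.
DISGUISE TEST (node test).  (A″) in either currency is a ONE-HISTORY SIZE bound on configuration-free majorants at the occurring
coupling; no second history, no difference, no modulus — not NE9 in disguise.

References (TYPES only): [Balaban1988RG2Cluster] CMP 116 (1988) (2.15) p. 15, (2.20) p. 16, (2.26) p. 17, (2.30) p. 18, Lemma 3
(2.38) p. 20; [Balaban1987RG1] CMP 109 (1987) p. 257 (d_j, connected families).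
-/

noncomputable section

namespace Summit.QuantumFields.BalabanUV.T4Continuum.NE9PrintedMajorantDecay

open scoped BigOperators
open Metric Set MeasureTheory BoundedContinuousFunction
open Literature.Probability.LatticeModels
open Literature.MathematicalPhysics.QuantumFieldTheory
open Literature.MathematicalPhysics.QuantumFieldTheory.Balaban1983to89
open Literature.MathematicalPhysics.QuantumFieldTheory.Balaban1983to89.T4OutputRate
open Literature.MathematicalPhysics.QuantumFieldTheory.Balaban1983to89.T4ActivityLipschitz
open Literature.MathematicalPhysics.QuantumFieldTheory.Balaban1983to89.T4HistoryLipschitzRecursion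
open Literature.MathematicalPhysics.QuantumFieldTheory.Balaban1983to89.T4HistoryLipschitzOuter
open Literature.MathematicalPhysics.QuantumFieldTheory.Balaban1983to89.T4HistoryLipschitzActivity
open Literature.MathematicalPhysics.QuantumFieldTheory.Balaban1983to89.T4HistoryLipschitzEntropy
open Literature.MathematicalPhysics.QuantumFieldTheory.Balaban1983to89.T4HistoryLipschitzCubeGeometry
open Literature.MathematicalPhysics.QuantumFieldTheory.Balaban1983to89.T4HistoryLipschitzActivity (ClusterGeom)
open Literature.MathematicalPhysics.QuantumFieldTheory.Balaban1983to89.T4HistoryLipschitzSegment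
open Literature.MathematicalPhysics.QuantumFieldTheory.Balaban1983to89.T4HistoryLipschitzLinearSize

variable {ν N : ℕ} {C : Carriers} {D : ℕ}
variable {Bg : Type} {Sp : Type*} [TopologicalSpace Sp] [MeasurableSpace Sp] [OpensMeasurableSpace Sp] {F : Type*}
  [Fintype F] {Ω : Type*} [MeasurableSpace Ω]

/-! ## §1 Decay in the linear size ⟹ decay in the number of cubes, for the box majorant on the step volume -/

omit [TopologicalSpace Sp] [MeasurableSpace Sp] [OpensMeasurableSpace Sp] in
/-- **(A″) IN PRINT'S CURRENCY FEEDS THE END'S CUBE-COUNT BINDER (kernel).**  On a torus cube chart every polymer of the step volume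
is a wall-connected cube family (`CubeChart.mem_vol`), hence has a skeleton (`isSkeleton_self_of_isConn`), hence
`e^{−a′·d(γ′)} ≤ e^{a′}·(e^{−a′/2^ν})^{#γ′}` (`exp_neg_mul_linSize_le`, the corrected lower half of [II] (2.30) p. 18); so decay of the
box majorant `∫‖pre_ω‖e^{boxExponent}dμ ≤ ε′ k·e^{−a′·d(γ′)}` (TYPE: Lemma 3 (2.38) p. 20 `|H(Z)| ≤ C₃ε₁ exp(−(1 − 8δ)½Lκd_{k+1}(Z))`
for ONE table; class-uniform form displayed) gives the END's `hdecay₀` with `ε k = ε′ k·e^{a′}`, `y = e^{−a′/2^ν}`.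
[cite: Balaban1988RG2Cluster, Lemma 3 (2.38) p.20 and (2.30) p.18; Balaban1987RG1, p.257] -/
theorem boxMajorantDecay_of_linSizeDecay (Γ : CubeChart C (Fin ν → ZMod N) (torusAdj ν N) D) {W : Set (ℕ → ℝ)}
    {μ : ℕ → ℝ → Bg → Finset (Fin ν → ZMod N) → Measure Ω} {pre : ℕ → ℝ → Bg → Finset (Fin ν → ZMod N) → Ω → ℂ}
    {c : ℕ → ℝ → Bg → Finset (Fin ν → ZMod N) → Ω → F → ℂ}
    {pt : ℕ → ℝ → Bg → Finset (Fin ν → ZMod N) → Ω → F → Sp} {β : ℕ → Sp → ℝ} {ε' : ℕ → ℝ} {a' : ℝ}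
    (hε' : ∀ k, 0 ≤ ε' k) (ha' : 0 ≤ a')
    (hdecayLin : ∀ g ∈ W, ∀ (k : ℕ) (U : Bg) (X : C.Dom), C.scale X = k + 1 → ∀ γ' ∈ Γ.vol X,
      ∫ ω, ‖pre k (g k) U γ' ω‖ * Real.exp (boxExponent c pt β k (g k) U γ' ω) ∂(μ k (g k) U γ') ≤
        ε' k * Real.exp (-(a' * (linSize γ' : ℝ)))) :
    ∀ g ∈ W, ∀ (k : ℕ) (U : Bg) (X : C.Dom), C.scale X = k + 1 → ∀ γ' ∈ Γ.vol X,
      ∫ ω, ‖pre k (g k) U γ' ω‖ * Real.exp (boxExponent c pt β k (g k) U γ' ω) ∂(μ k (g k) U γ') ≤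
        (ε' k * Real.exp a') * Real.exp (-(a' / 2 ^ ν)) ^ γ'.card := by
  intro g hg k U X hX γ' hγ'
  obtain ⟨-, b, -, hconn⟩ := Γ.mem_vol.1 hγ'
  have hsk : ∃ S, IsSkeleton γ' S := ⟨γ', isSkeleton_self_of_isConn (G := ZMod N) hconn⟩
  calc ∫ ω, ‖pre k (g k) U γ' ω‖ * Real.exp (boxExponent c pt β k (g k) U γ' ω) ∂(μ k (g k) U γ')
      ≤ ε' k * Real.exp (-(a' * (linSize γ' : ℝ))) := hdecayLin g hg k U X hX γ' hγ'
    _ ≤ ε' k * (Real.exp a' * Real.exp (-(a' / 2 ^ ν)) ^ γ'.card) :=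
        mul_le_mul_of_nonneg_left (exp_neg_mul_linSize_le ha' hsk) (hε' k)
    _ = (ε' k * Real.exp a') * Real.exp (-(a' / 2 ^ ν)) ^ γ'.card := by ring

/-! ## §2 The lineage's END on the torus cube chart with (A″) displayed in the linear size -/

/-- **NE9 ∧ FADING MEMORY ON A TORUS CUBE CHART, BOTH ACTIVITY-SIDE DECAYS IN BAŁABAN'S LINEAR SIZE (kernel end-to-end).**
`T4HistoryLipschitzLinearSize.torus_ne9_and_fadingMemory_of_linSizeDecay` with the box-majorant decay `hdecay₀` (cube-count currency
`ε k·y^{#γ′}`) REPLACED by `hdecayLin : ∫‖pre_ω‖e^{boxExponent}dμ ≤ ε′ k·e^{−a′·d(γ′)}` (TYPE (2.38) literally, `d = linSize`) and the KP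
scalars re-lettered through `ε k := ε′ k·e^{a′}`, `y := e^{−a′/2^ν}`: `hθ : 2·e^{−a′/2^ν}·e^{a₁+d₁}·e^{Dθ} ≤ θ`,
`hεθ : 2·(ε′ k·e^{a′})·θ·(D+1) ≤ a₁`.  All other binders verbatim ((L‴) `hlin` already in d-currency since v1 of the LinearSize leaf);
conclusion unchanged.  Nothing of [I]–[III] asserted; rung (B)+1 bookkeeping on a finite torus.
[cite: Balaban1988RG2Cluster, Lemma 3 (2.38) p.20, (2.18)-(2.20) p.16, (2.30) p.18, (1.26) p.8; Balaban1987RG1, (0.23) p.256, p.257, (1.18) p.263] -/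
theorem torus_ne9_and_fadingMemory_of_printedDecay (Γ : CubeChart C (Fin ν → ZMod N) (torusAdj ν N) D) {ι : Type}
    {E : Functional C Bg}
    {W : Set (ℕ → ℝ)} {Adm : Set (Bg → C.Dom → ℝ)} {T : ℕ → (ℕ → ℝ) → (Bg → C.Dom → ℝ) → ι → ℝ}
    {Ψ : ℕ → ℝ → (ι → ℝ) → Bg → C.Dom → ℝ}
    {μ : ℕ → ℝ → Bg → Finset (Fin ν → ZMod N) → Measure Ω} {pre : ℕ → ℝ → Bg → Finset (Fin ν → ZMod N) → Ω → ℂ}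
    {c : ℕ → ℝ → Bg → Finset (Fin ν → ZMod N) → Ω → F → ℂ}
    {pt : ℕ → ℝ → Bg → Finset (Fin ν → ZMod N) → Ω → F → Sp} {β : ℕ → Sp → ℝ}
    {dom : ℕ → Finset (Fin ν → ZMod N) → F → Finset (Fin ν → ZMod N)}
    {lip ε' α4 : ℕ → ℝ} {a₁ d₁ θ κ lipbar ℓ τbar ω a a' θ₁ : ℝ} {wt : ℕ → ι → ℝ} {τ : ℕ → ℕ → ℝ} {lam p₀ Nsz : ℕ → ℝ}
    (ρ : ℕ → (ι → ℝ) → (Sp →ᵇ ℂ))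
    (h0 : ScaleZeroFree E W) (hAdm : AdmissibleTerms E W Adm) (hres : AdmRestrict Adm)
    (hadd : ChannelAdditive Adm T) (hsum : ChannelStepSum Adm T) (hstep : ChannelSizeAtStepNN Adm T κ wt τ)
    (hfac : Factorises E W T Ψ) (hlast : LastCouplingLipschitz E W T Ψ κ lam)
    (hρ : ∀ (k : ℕ) (P P' : ι → ℝ) (M : ℝ), (∀ y, |P y - P' y| ≤ wt k y * M) → ‖ρ k P - ρ k P'‖ ≤ M)
    (hΨ : ∀ (k : ℕ) (s : ℝ) (P P' : ι → ℝ) (U : Bg) (X : C.Dom),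
      Ψ k s P U X - Ψ k s P' U X =
        (Γ.geom.newTerm (Γ.geom.avgExpLinearAct μ pre fun k s U γ ω => evalFunctional (c k s U γ ω) (pt k s U γ ω))
            k s U X (ρ k P) -
          Γ.geom.newTerm (Γ.geom.avgExpLinearAct μ pre fun k s U γ ω => evalFunctional (c k s U γ ω) (pt k s U γ ω))
            k s U X (ρ k P')).re)
    (hexpl : ∀ g ∈ W, ∀ (k : ℕ) (P : ι → ℝ) (U : Bg) (X : C.Dom), C.scale X = k + 1 →
      |Ψ k (g k) P U X -
          (Γ.geom.newTerm (Γ.geom.avgExpLinearAct μ pre fun k s U γ ω => evalFunctional (c k s U γ ω) (pt k s U γ ω))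
            k (g k) U X (ρ k P)).re| ≤ Real.exp (-(κ * C.d X)) * p₀ k)
    (hbase : ∀ g ∈ W, ∀ (U : Bg) (X : C.Dom), C.scale X = 0 → |E g U X| ≤ Real.exp (-(κ * C.d X)) * Nsz 0)
    (hNsucc : ∀ j, p₀ j + a₁ ≤ Nsz (j + 1)) (hNnn : ∀ j, 0 ≤ Nsz j)
    (hbox : ∀ (k : ℕ) (P : ι → ℝ), (∀ y, |P y| ≤ wt k y * sizeRadius τ Nsz k) → ∀ x, ‖ρ k P x‖ ≤ β k x)
    (hpre : ∀ k s U γ, AEStronglyMeasurable (pre k s U γ) (μ k s U γ))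
    (hc : ∀ k s U γ Y, AEStronglyMeasurable (fun ω => c k s U γ ω Y) (μ k s U γ))
    (hpt : ∀ k s U γ Y, Measurable fun ω => pt k s U γ ω Y) (hlip : ∀ k, 0 < lip k) (hlipb : ∀ k, lip k ≤ lipbar)
    (hint₀ : ∀ k s U γ, Integrable (fun ω => ‖pre k s U γ ω‖ * Real.exp (boxExponent c pt β k s U γ ω)) (μ k s U γ))
    (hmeet : ∀ k s U (γ : Finset (Fin ν → ZMod N)) ω Y, c k s U γ ω Y ≠ 0 → ∃ x ∈ γ, x ∈ dom k γ Y)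
    -- (L‴) decay of the coefficient tables in the linear size (unchanged from the LinearSize END)
    (hα4 : ∀ k, 0 ≤ α4 k) (ha : 0 ≤ a) (hθ₁ : Real.exp (-(a / 2 ^ ν)) * Real.exp (D * θ₁) ≤ θ₁)
    (hliplb : ∀ k, α4 k * Real.exp a * θ₁ ≤ lip k)
    (hlin : ∀ k s U (γ : Finset (Fin ν → ZMod N)) ω Y,
      ‖c k s U γ ω Y‖ ≤ α4 k * Real.exp (-(a * (linSize (dom k γ Y) : ℝ))))
    (hdomconn : ∀ k (γ : Finset (Fin ν → ZMod N)) Y, (dom k γ Y).Nonempty →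
      ∃ b ∈ dom k γ Y, Polymer.IsConn (torusAdj ν N) (dom k γ Y) b)
    (hdominj : ∀ k (γ : Finset (Fin ν → ZMod N)), Set.InjOn (dom k γ) {Y | (dom k γ Y).Nonempty})
    -- (A″) REPLACED: decay of the box majorant in the LINEAR SIZE of the polymer (TYPE (2.38))
    (hε' : ∀ k, 0 ≤ ε' k) (ha' : 0 ≤ a')
    (hdecayLin : ∀ g ∈ W, ∀ (k : ℕ) (U : Bg) (X : C.Dom), C.scale X = k + 1 → ∀ γ' ∈ Γ.vol X,
      ∫ ω, ‖pre k (g k) U γ' ω‖ * Real.exp (boxExponent c pt β k (g k) U γ' ω) ∂(μ k (g k) U γ') ≤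
        ε' k * Real.exp (-(a' * (linSize γ' : ℝ))))
    (hθ : 2 * Real.exp (-(a' / 2 ^ ν)) * Real.exp (a₁ + d₁) * Real.exp (D * θ) ≤ θ)
    (hεθ : ∀ k, 2 * (ε' k * Real.exp a') * θ * ((D : ℝ) + 1) ≤ a₁)
    (ha₁ : 0 ≤ a₁) (hκ : 0 ≤ κ) (hκd : κ ≤ d₁) (hℓ : 0 ≤ ℓ) (hτbar : 0 ≤ τbar) (hω : 0 ≤ ω)
    (hpos : 0 < ω + 4 * lipbar * a₁ * τbar) (hlam : ∀ k, lam k ≤ ℓ)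
    (hτ : ∀ k j, j ≤ k → 0 ≤ τ k j ∧ τ k j ≤ τbar * ω ^ (k - j)) :
    NE9 E W κ (prodModuli ℓ fun _ => ω + 4 * lipbar * a₁ * τbar) ∧
      FadingMemory (ℓ / (ω + 4 * lipbar * a₁ * τbar)) (ω + 4 * lipbar * a₁ * τbar)
        (prodModuli ℓ fun _ => ω + 4 * lipbar * a₁ * τbar) :=
  torus_ne9_and_fadingMemory_of_linSizeDecay Γ ρ h0 hAdm hres hadd hsum hstep hfac hlast hρ hΨ hexpl hbase hNsucc hNnn hbox
    hpre hc hpt hlip hlipb hint₀ hmeet hα4 ha hθ₁ hliplb hlin hdomconn hdominj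
    (fun k => mul_nonneg (hε' k) (Real.exp_pos a').le) (Real.exp_pos _).le
    (boxMajorantDecay_of_linSizeDecay Γ hε' ha' hdecayLin) hθ hεθ ha₁ hκ hκd hℓ hτbar hω hpos hlam hτ

end Summit.QuantumFields.BalabanUV.T4Continuum.NE9PrintedMajorantDecay

end
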